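import Summits.CriticalPhenomena.PercolationContinuityZ3.Theorems.PercNearOneGluingNoHeavyPcintNawChainWindow
import HarnessLib

/-!
# PCINT lane, kind `nawchain_cw` (B2c): window certificates — kernel form

Cell `prim-pcint`, seat `prim-pcint-2` (gen 3); memo `run/shared/lean/prim/pcint/REDUCTIONS.md` §B2c.  Does NOT build on
p205010.

Per-word domination `nawChainWeight_core_le_prod`: for a neighbour-avoiding word the B2c weight
`q^{incForcedTotal} ((1+q²)/2)^{cornerOnlyTotal}` is at most the product over its windows of the factors
`q̄^{u} · coinFactor q̄ c` for any computable counts `u ≤ winUnitsTrue`, `c ≤ winCoinTrue` (each gap site pays at most its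
number of incidences, `sum_payW_le_card_incTimes`; a paid corner site without deterministic evidence that is not a gap site is a
corner-only corner); and the certificate theorem `le_siteCriticalProb_zd_of_nawChainWindowCert : … → p ≤ p_c^site(ℤ^d)`.
-/

noncomputable section

namespace Summit.CriticalPhenomena.PercolationContinuityZ3.Theorems.Pcint

open Finset Literature.Probability.Percolation Literature.Probability.LatticeModels

variable {d m : ℕ} (a₀ : Fin d × Bool)

/-- `stepVec` is injective. [folklore] -/
private theorem stepVec_inj' {e e' : Fin d × Bool} (h : stepVec e = stepVec e') : e = e' := by
  obtain ⟨i, b⟩ := e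
  obtain ⟨i', b'⟩ := e'
  have hi : i = i' := by
    by_contra hne
    have h1 := congrFun h i
    cases b <;> cases b' <;> simp [stepVec, Pi.single_eq_of_ne hne] at h1
  subst hi
  have h1 := congrFun h i
  cases b <;> cases b' <;> simp [stepVec] at h1 ⊢

/-! ### Per-word domination -/

section Dominate

variable {k : ℕ} {γ : Fin (m + 1 + k) → Fin d × Bool} (hs : IsSAW γ) (hch : chordEdges γ = ∅) (kc : ℕ)

open Classical in
/-- Word-level unconditional units at window `t`: payments of the neighbours of `v_{t+m+2}` with deterministic
evidence. [folklore] -/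
private def unitsW (kc : ℕ) (γ : Fin (m + 1 + k) → Fin d × Bool) (t : ℕ) : ℕ :=
  ∑ e : Fin d × Bool, if IsDetW (m + 2) γ (t + m + 2) (wordPos γ (t + m + 2) + stepVec e) then
    payW (m + 2) kc γ (t + m + 2) (wordPos γ (t + m + 2) + stepVec e) else 0

open Classical in
/-- Word-level conditional units at window `t`: the payment of the corner site without deterministic evidence.
[folklore] -/
private def coinW (kc : ℕ) (γ : Fin (m + 1 + k) → Fin d × Bool) (t : ℕ) : ℕ :=
  ∑ e : Fin d × Bool, if ¬ IsDetW (m + 2) γ (t + m + 2) (wordPos γ (t + m + 2) + stepVec e) ∧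
      wordPos γ (t + m + 2) + stepVec e = cornerSite γ (t + m) then
    payW (m + 2) kc γ (t + m + 2) (wordPos γ (t + m + 2) + stepVec e) else 0

open Classical in
/-- All payments of window `t` at gap sites. [folklore] -/
private def gapPayW (kc : ℕ) (γ : Fin (m + 1 + k) → Fin d × Bool) (t : ℕ) : ℕ :=
  ∑ e : Fin d × Bool, if wordPos γ (t + m + 2) + stepVec e ∈ gapSites γ then
    payW (m + 2) kc γ (t + m + 2) (wordPos γ (t + m + 2) + stepVec e) else 0

variable {kc}

include hch in
/-- The genuine window counts are the word-level ones. [folklore] -/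
theorem winUnitsTrue_eq {t : ℕ} (ht : t < k) :
    winUnitsTrue kc (winAt (m := m + 1) a₀ γ t) (wordAt a₀ γ (t + (m + 1))) = unitsW kc γ t := by
  classical
  unfold winUnitsTrue unitsW IsWinDet winPay
  refine sum_congr rfl fun e _ => ?_
  rw [show IsDetW (m + 2) (wext (winAt (m := m + 1) a₀ γ t) (wordAt a₀ γ (t + (m + 1)))) (m + 2)
      (winNbr (winAt a₀ γ t) (wordAt a₀ γ (t + (m + 1))) e) ↔ _ from isDetW_win_iff a₀ ht,
    payW_win_eq a₀ hch ht, winNbr_add a₀ ht]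

include hch in
/-- The genuine window coin count is the word-level one. [folklore] -/
theorem winCoinTrue_eq {t : ℕ} (ht : t < k) :
    winCoinTrue kc (winAt (m := m + 1) a₀ γ t) (wordAt a₀ γ (t + (m + 1))) = coinW kc γ t := by
  classical
  unfold winCoinTrue coinW IsWinDet winPay
  refine sum_congr rfl fun e _ => ?_
  rw [show IsDetW (m + 2) (wext (winAt (m := m + 1) a₀ γ t) (wordAt a₀ γ (t + (m + 1)))) (m + 2)
      (winNbr (winAt a₀ γ t) (wordAt a₀ γ (t + (m + 1))) e) ↔ _ from isDetW_win_iff a₀ ht,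
    isCornerDir_win_iff a₀ ht, payW_win_eq a₀ hch ht, winNbr_add a₀ ht]
  split_ifs <;> rfl

/-- Units plus the corner payment at a gap corner site are payments at gap sites. [folklore] -/
theorem unitsW_add_le_gapPayW (t : ℕ) (ht : t < k) :
    unitsW kc γ t + (if cornerSite γ (t + m) ∈ gapSites γ then coinW kc γ t else 0) ≤ gapPayW kc γ t := by
  classical
  have hT : t + m + 2 ≤ m + 1 + k := by omega
  -- termwise bounds
  have hdet : ∀ e : Fin d × Bool,
      (if IsDetW (m + 2) γ (t + m + 2) (wordPos γ (t + m + 2) + stepVec e) then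
        payW (m + 2) kc γ (t + m + 2) (wordPos γ (t + m + 2) + stepVec e) else 0) ≤
      (if wordPos γ (t + m + 2) + stepVec e ∈ gapSites γ then
        payW (m + 2) kc γ (t + m + 2) (wordPos γ (t + m + 2) + stepVec e) else 0) := by
    intro e
    set x := wordPos γ (t + m + 2) + stepVec e
    by_cases hd : IsDetW (m + 2) γ (t + m + 2) x
    · rw [if_pos hd]
      by_cases hp : 0 < payW (m + 2) kc γ (t + m + 2) x
      · rw [if_pos (isDetW_mem_gapSites hT (isLinkedW_of_payW_pos hp) hd)]
      · have h0 : payW (m + 2) kc γ (t + m + 2) x = 0 := by omega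
        rw [h0]; exact Nat.zero_le _
    · rw [if_neg hd]; exact Nat.zero_le _
  have hcoin : cornerSite γ (t + m) ∈ gapSites γ → ∀ e : Fin d × Bool,
      (if IsDetW (m + 2) γ (t + m + 2) (wordPos γ (t + m + 2) + stepVec e) then
        payW (m + 2) kc γ (t + m + 2) (wordPos γ (t + m + 2) + stepVec e) else 0) +
      (if ¬ IsDetW (m + 2) γ (t + m + 2) (wordPos γ (t + m + 2) + stepVec e) ∧
          wordPos γ (t + m + 2) + stepVec e = cornerSite γ (t + m) then
        payW (m + 2) kc γ (t + m + 2) (wordPos γ (t + m + 2) + stepVec e) else 0) ≤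
      (if wordPos γ (t + m + 2) + stepVec e ∈ gapSites γ then
        payW (m + 2) kc γ (t + m + 2) (wordPos γ (t + m + 2) + stepVec e) else 0) := by
    intro hcg e
    set x := wordPos γ (t + m + 2) + stepVec e
    by_cases hd : IsDetW (m + 2) γ (t + m + 2) x
    · have h1 := hdet e
      rw [if_pos hd] at h1 ⊢
      rw [if_neg (fun h => h.1 hd), add_zero]
      exact h1
    · rw [if_neg hd, zero_add]
      by_cases hxc : x = cornerSite γ (t + m)
      · rw [if_pos ⟨hd, hxc⟩, if_pos (hxc ▸ hcg)]
      · rw [if_neg (fun h => hxc h.2)]; exact Nat.zero_le _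
  by_cases hcg : cornerSite γ (t + m) ∈ gapSites γ
  · rw [if_pos hcg, unitsW, coinW, gapPayW, ← sum_add_distrib]
    exact sum_le_sum fun e _ => hcoin hcg e
  · rw [if_neg hcg, add_zero, unitsW, gapPayW]
    exact sum_le_sum fun e _ => hdet e

/-- The sum of the gap-site payments over all windows is at most `incForcedTotal`. [folklore] -/
theorem sum_gapPayW_le : ∑ t ∈ range k, gapPayW kc γ t ≤ incForcedTotal γ := by
  classical
  -- per window: reindex the directions by the neighbour sites
  have h1 : ∀ t ∈ range k, gapPayW kc γ t ≤ ∑ x ∈ gapSites γ, payW (m + 2) kc γ (t + m + 2) x := by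
    intro t _
    set f : Fin d × Bool → Site d := fun e => wordPos γ (t + m + 2) + stepVec e with hf
    set g : Site d → ℕ := fun x => if x ∈ gapSites γ then payW (m + 2) kc γ (t + m + 2) x else 0 with hg
    have hinj : Function.Injective f := fun e e' h => stepVec_inj' (add_left_cancel h)
    have hsi : ∑ x ∈ (univ : Finset (Fin d × Bool)).image f, g x = ∑ e : Fin d × Bool, g (f e) :=
      sum_image fun e _ e' _ h => hinj h
    have hgap : gapPayW kc γ t = ∑ e : Fin d × Bool, g (f e) := rfl
    rw [hgap, ← hsi, hg, ← sum_filter]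
    exact sum_le_sum_of_subset_of_nonneg (fun x hx => (mem_filter.1 hx).2) fun _ _ _ => Nat.zero_le _
  refine (sum_le_sum h1).trans ?_
  rw [sum_comm, incForcedTotal]
  refine sum_le_sum fun x _ => ?_
  -- reindex the windows by their times `T = t + m + 2 ≤ m + 1 + k`
  have hsi : ∑ T ∈ (range k).image (fun t => t + m + 2), payW (m + 2) kc γ T x =
      ∑ t ∈ range k, payW (m + 2) kc γ (t + m + 2) x :=
    sum_image fun t _ t' _ h => by omega
  rw [← hsi]
  calc ∑ T ∈ (range k).image (fun t => t + m + 2), payW (m + 2) kc γ T x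
      ≤ ∑ T ∈ range (m + 1 + k + 1), payW (m + 2) kc γ T x :=
        sum_le_sum_of_subset_of_nonneg (fun T hT => by
          obtain ⟨t, ht, rfl⟩ := mem_image.1 hT
          have := mem_range.1 ht
          exact mem_range.2 (by omega)) fun _ _ _ => Nat.zero_le _
    _ ≤ (incTimes γ x).card := sum_payW_le_card_incTimes _ _ γ x

/-- The conditional units of a window are at most `2`. [folklore] -/
theorem coinW_le_two (t : ℕ) : coinW kc γ t ≤ 2 := by
  classical
  rw [coinW]
  set f : Fin d × Bool → Site d := fun e => wordPos γ (t + m + 2) + stepVec e with hf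
  have hinj : Function.Injective f := fun e e' h => stepVec_inj' (add_left_cancel h)
  calc ∑ e : Fin d × Bool, (if ¬ IsDetW (m + 2) γ (t + m + 2) (f e) ∧ f e = cornerSite γ (t + m) then
        payW (m + 2) kc γ (t + m + 2) (f e) else 0)
      ≤ ∑ e : Fin d × Bool, (if f e = cornerSite γ (t + m) then 2 else 0) :=
        sum_le_sum fun e _ => by
          split_ifs with h1 h2 h2
          · exact payW_le_two _ _ _ _ _
          · exact absurd h1.2 h2
          · exact Nat.zero_le _
          · exact le_rfl
    _ = 2 * ((univ : Finset (Fin d × Bool)).filter fun e => f e = cornerSite γ (t + m)).card := by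
        rw [← sum_filter, sum_const, smul_eq_mul, mul_comm]
    _ ≤ 2 * 1 := by
        refine Nat.mul_le_mul_left 2 (card_le_one.2 fun e he e' he' => hinj ?_)
        rw [(mem_filter.1 he).2, (mem_filter.1 he').2]
    _ = 2 := rfl

include hs in
/-- **A paid corner site without deterministic evidence which is not a gap site is a corner-only corner.** [folklore] -/
theorem mem_cornerOnlyTimes_of_coinW_pos {t : ℕ} (ht : t < k) (hpos : 0 < coinW kc γ t)
    (hng : cornerSite γ (t + m) ∉ gapSites γ) : (⟨t + m, by omega⟩ : Fin (m + 1 + k)) ∈ cornerOnlyTimes γ := by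
  classical
  -- a direction pays at the corner site, without deterministic evidence
  obtain ⟨e, -, he⟩ := exists_ne_zero_of_sum_ne_zero (by rw [coinW] at hpos; exact Nat.pos_iff_ne_zero.1 hpos)
  simp only at he
  have hcond : ¬ IsDetW (m + 2) γ (t + m + 2) (wordPos γ (t + m + 2) + stepVec e) ∧
      wordPos γ (t + m + 2) + stepVec e = cornerSite γ (t + m) := by
    by_contra h; rw [if_neg h] at he; exact he rfl
  obtain ⟨hnd, hxe⟩ := hcond
  rw [if_pos ⟨hnd, hxe⟩] at he
  have hl := isLinkedW_of_payW_pos (Nat.pos_of_ne_zero he)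
  rw [hxe] at hl hnd
  have hT : t + m + 2 ≤ m + 1 + k := by omega
  obtain ⟨hadjT, hoff, -⟩ := hl
  refine mem_filter.2 ⟨mem_cornerTimes.2 ⟨hT, ?_, hoff, fun i hi => ?_⟩, hng⟩
  · -- perpendicularity: same axis would put the corner site on the path or break self-avoidance
    intro hax
    have hcs : cornerSite γ (t + m) = wordPos γ (t + m) + stepVec (γ ⟨t + m + 1, by omega⟩) := by
      rw [cornerSite, dif_pos (by omega : t + m + 1 < m + 1 + k)]
    have hT1 : wordPos γ (t + m + 1) = wordPos γ (t + m) + stepVec (γ ⟨t + m, by omega⟩) := wordPos_succ γ (by omega)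
    have hT2 : wordPos γ (t + m + 2) = wordPos γ (t + m + 1) + stepVec (γ ⟨t + m + 1, by omega⟩) :=
      wordPos_succ γ (by omega)
    by_cases hsg : (γ ⟨t + m, by omega⟩).2 = (γ ⟨t + m + 1, by omega⟩).2
    · have heq : γ ⟨t + m, by omega⟩ = γ ⟨t + m + 1, by omega⟩ := Prod.ext hax hsg
      exact hoff (mem_pathSites.2 ⟨t + m + 1, by omega, by rw [hT1, heq, hcs]⟩)
    · have hrev : γ ⟨t + m, by omega⟩ = srev (γ ⟨t + m + 1, by omega⟩) := by
        rw [srev]; refine Prod.ext hax ?_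
        cases hb : (γ ⟨t + m, by omega⟩).2 <;> cases hb' : (γ ⟨t + m + 1, by omega⟩).2 <;> simp_all
      have hTS : wordPos γ (t + m + 2) = wordPos γ (t + m) := by
        rw [hT2, hT1, hrev, stepVec_srev]; abel
      have := hs (t + m + 2) (t + m) (by omega) (by omega) hTS
      omega
  · -- no old incidence: it would make the corner site a gap site
    have hi' : i < t + m := by simpa using mem_range.1 hi
    have hl' : IsLinkedW (m + 2) kc γ (t + m + 2) (cornerSite γ (t + m)) := by
      have := isLinkedW_of_payW_pos (Nat.pos_of_ne_zero he); rwa [hxe] at this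
    exact not_adj_of_not_mem_gapSites hT hl' hng (by omega)

/-- The number of corner-only coin windows is at most `cornerOnlyTotal`. [folklore] -/
theorem card_coinWindows_le (hs : IsSAW γ) :
    ((range k).filter fun t => cornerSite γ (t + m) ∉ gapSites γ ∧ 0 < coinW kc γ t).card ≤ cornerOnlyTotal γ := by
  classical
  set S := (range k).filter fun t => cornerSite γ (t + m) ∉ gapSites γ ∧ 0 < coinW kc γ t with hS
  rw [cornerOnlyTotal]
  calc S.card = (S.image fun t => t + m).card := (card_image_of_injective _ fun t t' h => by simpa using h).symm
    _ ≤ ((cornerOnlyTimes γ).image Fin.val).card := by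
        refine card_le_card fun x hx => ?_
        obtain ⟨t, ht, rfl⟩ := mem_image.1 hx
        obtain ⟨htk, hng, hpos⟩ := mem_filter.1 ht
        have htk' := mem_range.1 htk
        exact mem_image.2 ⟨⟨t + m, by omega⟩, mem_cornerOnlyTimes_of_coinW_pos (kc := kc) hs htk' hpos hng, rfl⟩
    _ = (cornerOnlyTimes γ).card := card_image_of_injective _ Fin.val_injective

include hs hch in
/-- **Per-word domination (B2c).**  For a neighbour-avoiding word and computable counts `uN ≤ winUnitsTrue`,
`ceN ≤ winCoinTrue` on its windows, with `0 ≤ q ≤ q̄ ≤ 1`: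
`q^{incForcedTotal γ} ((1+q²)/2)^{cornerOnlyTotal γ} ≤ ∏_t q̄^{uN_t} · coinFactor q̄ (ceN_t)`. [folklore] -/
theorem nawChainWeight_core_le_prod (uN ceN : (Fin (m + 1) → Fin d × Bool) → Fin d × Bool → ℕ)
    (hu : ∀ t < k, uN (winAt (m := m + 1) a₀ γ t) (wordAt a₀ γ (t + (m + 1))) ≤
      winUnitsTrue kc (winAt (m := m + 1) a₀ γ t) (wordAt a₀ γ (t + (m + 1))))
    (hc : ∀ t < k, ceN (winAt (m := m + 1) a₀ γ t) (wordAt a₀ γ (t + (m + 1))) ≤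
      winCoinTrue kc (winAt (m := m + 1) a₀ γ t) (wordAt a₀ γ (t + (m + 1))))
    {q qb : ℝ} (hq0 : 0 ≤ q) (hqb : q ≤ qb) (hqb1 : qb ≤ 1) :
    q ^ incForcedTotal γ * ((1 + q ^ 2) / 2) ^ cornerOnlyTotal γ ≤
      ∏ t ∈ range k, (qb ^ uN (winAt (m := m + 1) a₀ γ t) (wordAt a₀ γ (t + (m + 1))) *
        coinFactor qb (ceN (winAt (m := m + 1) a₀ γ t) (wordAt a₀ γ (t + (m + 1))))) := by
  classical
  have hqb0 : 0 ≤ qb := hq0.trans hqb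
  have hq1 : q ≤ 1 := hqb.trans hqb1
  -- per-window lower bound of the computable factor
  have hstep : ∀ t ∈ range k,
      qb ^ (unitsW kc γ t + (if cornerSite γ (t + m) ∈ gapSites γ then coinW kc γ t else 0)) *
        (if cornerSite γ (t + m) ∉ gapSites γ ∧ 0 < coinW kc γ t then (1 + qb ^ 2) / 2 else 1) ≤
      qb ^ uN (winAt (m := m + 1) a₀ γ t) (wordAt a₀ γ (t + (m + 1))) *
        coinFactor qb (ceN (winAt (m := m + 1) a₀ γ t) (wordAt a₀ γ (t + (m + 1)))) := by
    intro t ht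
    have ht' := mem_range.1 ht
    have hu' := hu t ht'
    have hc' := hc t ht'
    rw [winUnitsTrue_eq a₀ hch ht'] at hu'
    rw [winCoinTrue_eq a₀ hch ht'] at hc'
    set u := uN (winAt (m := m + 1) a₀ γ t) (wordAt a₀ γ (t + (m + 1)))
    set c := ceN (winAt (m := m + 1) a₀ γ t) (wordAt a₀ γ (t + (m + 1)))
    have hc2 : coinW kc γ t ≤ 2 := coinW_le_two t
    have hpu : qb ^ unitsW kc γ t ≤ qb ^ u := pow_le_pow_of_le_one hqb0 hqb1 hu'
    -- coin part
    have hcoin1 : ∀ n : ℕ, 1 ≤ n → n ≤ coinW kc γ t → qb ^ coinW kc γ t ≤ coinFactor qb n ∧ (1 + qb ^ 2) / 2 ≤ coinFactor qb n := by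
      intro n hn1 hn2
      rw [coinFactor, if_neg (by omega)]
      have h1 : qb ^ coinW kc γ t ≤ qb ^ n := pow_le_pow_of_le_one hqb0 hqb1 hn2
      have h2 : qb ^ n ≤ 1 := pow_le_one₀ hqb0 hqb1
      have h3 : qb ^ 2 ≤ qb ^ n := pow_le_pow_of_le_one hqb0 hqb1 (by omega)
      constructor <;> linarith
    have hcf1 : ∀ n : ℕ, coinFactor qb n ≤ 1 := fun n => by
      unfold coinFactor; split_ifs
      · exact le_rfl
      · have := pow_le_one₀ (n := n) hqb0 hqb1; linarith
    have hcf0 : ∀ n : ℕ, 0 ≤ coinFactor qb n := fun n => by unfold coinFactor; split_ifs <;> positivity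
    by_cases hcg : cornerSite γ (t + m) ∈ gapSites γ
    · rw [if_pos hcg, if_neg (fun h => h.1 hcg), mul_one, pow_add]
      by_cases hc0 : c = 0
      · calc qb ^ unitsW kc γ t * qb ^ coinW kc γ t ≤ qb ^ u * 1 :=
              mul_le_mul hpu (pow_le_one₀ hqb0 hqb1) (pow_nonneg hqb0 _) (pow_nonneg hqb0 _)
          _ = qb ^ u * coinFactor qb c := by rw [coinFactor, if_pos hc0]
      · exact mul_le_mul hpu (hcoin1 c (by omega) hc').1 (pow_nonneg hqb0 _) (pow_nonneg hqb0 _)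
    · rw [if_neg hcg, add_zero]
      by_cases hpos : 0 < coinW kc γ t
      · rw [if_pos ⟨hcg, hpos⟩]
        by_cases hc0 : c = 0
        · calc qb ^ unitsW kc γ t * ((1 + qb ^ 2) / 2) ≤ qb ^ u * 1 :=
                mul_le_mul hpu (by have := pow_le_one₀ (n := 2) hqb0 hqb1; linarith) (by positivity) (pow_nonneg hqb0 _)
            _ = qb ^ u * coinFactor qb c := by rw [coinFactor, if_pos hc0]
        · exact mul_le_mul hpu (hcoin1 c (by omega) hc').2 (by positivity) (pow_nonneg hqb0 _)
      · rw [if_neg (fun h => hpos h.2), mul_one]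
        calc qb ^ unitsW kc γ t ≤ qb ^ u * 1 := by rw [mul_one]; exact hpu
          _ ≤ qb ^ u * coinFactor qb c := by
              have hc00 : c = 0 := by omega
              rw [coinFactor, if_pos hc00]
  -- the product of the lower bounds
  have hprod : ∏ t ∈ range k, (qb ^ (unitsW kc γ t + (if cornerSite γ (t + m) ∈ gapSites γ then coinW kc γ t else 0)) *
        (if cornerSite γ (t + m) ∉ gapSites γ ∧ 0 < coinW kc γ t then (1 + qb ^ 2) / 2 else 1)) =
      qb ^ (∑ t ∈ range k, (unitsW kc γ t + (if cornerSite γ (t + m) ∈ gapSites γ then coinW kc γ t else 0))) *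
        ((1 + qb ^ 2) / 2) ^ ((range k).filter fun t => cornerSite γ (t + m) ∉ gapSites γ ∧ 0 < coinW kc γ t).card := by
    rw [prod_mul_distrib, prod_pow_eq_pow_sum, prod_ite, prod_const_one, mul_one, prod_const]
  have hAsum : ∑ t ∈ range k, (unitsW kc γ t + (if cornerSite γ (t + m) ∈ gapSites γ then coinW kc γ t else 0)) ≤
      incForcedTotal γ :=
    (sum_le_sum fun t ht => unitsW_add_le_gapPayW (kc := kc) t (mem_range.1 ht)).trans sum_gapPayW_le
  have hCcard : ((range k).filter fun t => cornerSite γ (t + m) ∉ gapSites γ ∧ 0 < coinW kc γ t).card ≤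
      cornerOnlyTotal γ := card_coinWindows_le hs
  have hκ0 : (0 : ℝ) ≤ (1 + qb ^ 2) / 2 := by positivity
  have hκ1 : (1 + qb ^ 2) / 2 ≤ 1 := by have := pow_le_one₀ (n := 2) hqb0 hqb1; linarith
  calc q ^ incForcedTotal γ * ((1 + q ^ 2) / 2) ^ cornerOnlyTotal γ
      ≤ qb ^ incForcedTotal γ * ((1 + qb ^ 2) / 2) ^ cornerOnlyTotal γ :=
        mul_le_mul (pow_le_pow_left₀ hq0 hqb _) (pow_le_pow_left₀ (by positivity)
          (by have := pow_le_pow_left₀ hq0 hqb 2; linarith) _) (by positivity) (pow_nonneg hqb0 _)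
    _ ≤ qb ^ (∑ t ∈ range k, (unitsW kc γ t + (if cornerSite γ (t + m) ∈ gapSites γ then coinW kc γ t else 0))) *
        ((1 + qb ^ 2) / 2) ^ ((range k).filter fun t => cornerSite γ (t + m) ∉ gapSites γ ∧ 0 < coinW kc γ t).card :=
        mul_le_mul (pow_le_pow_of_le_one hqb0 hqb1 hAsum) (pow_le_pow_of_le_one hκ0 hκ1 hCcard)
          (pow_nonneg hκ0 _) (pow_nonneg hqb0 _)
    _ = _ := hprod.symm
    _ ≤ _ := prod_le_prod (fun t _ => mul_nonneg (pow_nonneg hqb0 _) (by split_ifs <;> positivity)) hstep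

end Dominate

/-! ### The certificate theorem -/

/-- **B2c window certificate ⇒ lower bound on `p_c^site(ℤ^d)`** (kernel form of REDUCTIONS §R2.5 for kind
`nawchain_cw`, windows of `m + 1` steps, chain parameter `kc`).  Data: an acceptance test `ok` accepting every
neighbour-avoiding extended window; computable counts `uN ≤ winUnitsTrue kc`, `ceN ≤ winCoinTrue kc`; constants
`0 ≤ q ≤ q̄ ≤ 1`, `q^{2d} ≥ 1 - p`; and a positive vector `v` with the Collatz–Wielandt inequalities
`Σ_a [ok u a] p q̄^{uN u a} coinFactor q̄ (ceN u a) v(wshift u a) ≤ λ v(u)`, `λ < 1`.  Then `p ≤ p_c^site(ℤ^d)`. [folklore] -/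
theorem le_siteCriticalProb_zd_of_nawChainWindowCert (a₀ : Fin d × Bool) (kc : ℕ)
    (ok : (Fin (m + 1) → Fin d × Bool) → Fin d × Bool → Bool)
    (uN ceN : (Fin (m + 1) → Fin d × Bool) → Fin d × Bool → ℕ)
    (hok : ∀ u a, IsSAW (wext u a) → chordEdges (wext u a) = ∅ → ok u a = true)
    (hu : ∀ u a, IsSAW (wext u a) → chordEdges (wext u a) = ∅ → uN u a ≤ winUnitsTrue kc u a)
    (hce : ∀ u a, IsSAW (wext u a) → chordEdges (wext u a) = ∅ → ceN u a ≤ winCoinTrue kc u a)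
    (p : unitInterval) {q qb : ℝ} (hq0 : 0 ≤ q) (hqb : q ≤ qb) (hqb1 : qb ≤ 1)
    (hpq : 1 - (p : ℝ) ≤ q ^ (2 * d))
    (v : (Fin (m + 1) → Fin d × Bool) → ℝ) {vmin vmax lam : ℝ} (hvmin : 0 < vmin)
    (hv : ∀ u, vmin ≤ v u) (hvmax : ∀ u, v u ≤ vmax) (hlam0 : 0 < lam) (hlam1 : lam < 1)
    (hcw : ∀ u, (∑ a : Fin d × Bool, if ok u a then
      (p : ℝ) * (qb ^ uN u a * coinFactor qb (ceN u a)) * v (wshift u a) else 0) ≤ lam * v u) :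
    (p : ℝ) ≤ siteCriticalProb (zdGraph d) 0 := by
  classical
  have hp0 : (0 : ℝ) ≤ p := p.2.1
  have hp1 : (p : ℝ) ≤ 1 := p.2.2
  have hqb0 : 0 ≤ qb := hq0.trans hqb
  have hq1 : q ≤ 1 := hqb.trans hqb1
  have hcf0 : ∀ c : ℕ, 0 ≤ coinFactor qb c := fun c => by unfold coinFactor; split_ifs <;> positivity
  set wt : (Fin (m + 1) → Fin d × Bool) → Fin d × Bool → ℝ :=
    fun u a => (p : ℝ) * (qb ^ uN u a * coinFactor qb (ceN u a)) with hwt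
  have hwt0 : ∀ u a, 0 ≤ wt u a := fun u a => by
    rw [hwt]; exact mul_nonneg hp0 (mul_nonneg (pow_nonneg hqb0 _) (hcf0 _))
  set M := windowAutW ok wt hwt0 with hM
  have hcw' : ∀ u, M.stepSum v u ≤ lam * v u := fun u => by rw [hM, stepSum_windowAutW]; exact hcw u
  have hdom : ∀ (k : ℕ) (γ : Fin (m + 1 + k) → Fin d × Bool),
      γ ∈ (sawWords d (m + 1 + k)).filter (fun w => chordEdges w = ∅) →
      nawChainWeight p q γ ≤ (p : ℝ) ^ (m + 2) * M.run k (winAt a₀ γ 0) (fun j => γ ⟨m + 1 + j.1, by omega⟩) := by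
    intro k γ hγ
    obtain ⟨hsaw, hch⟩ := mem_filter.1 hγ
    have hs : IsSAW γ := mem_sawWords.1 hsaw
    have hwin : ∀ t < k, IsSAW (wext (winAt (m := m + 1) a₀ γ t) (wordAt a₀ γ (t + (m + 1)))) ∧
        chordEdges (wext (winAt (m := m + 1) a₀ γ t) (wordAt a₀ γ (t + (m + 1)))) = ∅ :=
      fun t ht => ⟨isSAW_wext_winAt a₀ hs (by omega), chordEdges_wext_winAt a₀ hch (by omega)⟩
    rw [hM, run_windowAutW_eq a₀ ok wt hwt0 k γ (fun t ht => hok _ _ (hwin t ht).1 (hwin t ht).2)]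
    have hprod : ∏ t ∈ range k, wt (winAt a₀ γ t) (wordAt a₀ γ (t + (m + 1))) =
        (p : ℝ) ^ k * ∏ t ∈ range k, (qb ^ uN (winAt a₀ γ t) (wordAt a₀ γ (t + (m + 1))) *
          coinFactor qb (ceN (winAt a₀ γ t) (wordAt a₀ γ (t + (m + 1))))) := by
      rw [hwt, prod_mul_distrib, prod_const, card_range]
    rw [hprod, nawChainWeight, show m + 1 + k + 1 = (m + 2) + k by ring, pow_add]
    have core := nawChainWeight_core_le_prod a₀ hs hch uN ceN (fun t ht => hu _ _ (hwin t ht).1 (hwin t ht).2)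
      (fun t ht => hce _ _ (hwin t ht).1 (hwin t ht).2) hq0 hqb hqb1 (kc := kc)
    calc (p : ℝ) ^ (m + 2) * (p : ℝ) ^ k * q ^ incForcedTotal γ * ((1 + q ^ 2) / 2) ^ cornerOnlyTotal γ
        = ((p : ℝ) ^ (m + 2) * (p : ℝ) ^ k) * (q ^ incForcedTotal γ * ((1 + q ^ 2) / 2) ^ cornerOnlyTotal γ) := by ring
      _ ≤ ((p : ℝ) ^ (m + 2) * (p : ℝ) ^ k) * _ :=
          mul_le_mul_of_nonneg_left core (mul_nonneg (pow_nonneg hp0 _) (pow_nonneg hp0 _))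
      _ = _ := by ring
  have hκ0 : (0 : ℝ) ≤ (1 + q ^ 2) / 2 := by positivity
  have hκ1 : (1 + q ^ 2) / 2 ≤ 1 := by have := pow_le_one₀ (n := 2) hq0 hq1; linarith
  obtain ⟨C, hC⟩ := sum_le_geometric_of_windowCertW a₀ ok wt hwt0
    (fun n => (sawWords d n).filter fun w => chordEdges w = ∅) (fun n γ => nawChainWeight p q γ)
    (fun n γ _ => by
      unfold nawChainWeight
      exact mul_le_one₀ (mul_le_one₀ (pow_le_one₀ hp0 hp1) (pow_nonneg hq0 _) (pow_le_one₀ hq0 hq1))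
        (pow_nonneg hκ0 _) (pow_le_one₀ hκ0 hκ1))
    (pow_nonneg hp0 (m + 2)) (pow_le_one₀ hp0 hp1) hdom v hvmin hv hvmax hlam0 hcw'
  exact le_siteCriticalProb_zd_of_nawChain_le_geometric d p hq0 hq1 hpq hlam0.le hlam1 hC

end Summit.CriticalPhenomena.PercolationContinuityZ3.Theorems.Pcint
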